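import Literature.NumberTheory.EllipticCurves.IwasawaSelmerControlAwayFromPProofs
import Literature.NumberTheory.EllipticCurves.KodairaNeronUnramifiedInertiaProofs
import HarnessLib

/-!
# `E(K̄_v)^H` is `p`-divisible modulo `p`-power torsion for every `H ⊇ I_v` (`v ∤ p`)
# (cell `b2b-bsdres`, team n1011, seat p06 GEN 5; OWNERS row T-E3g-DOOR, FILE A)

HONEST FRAMING (cell `b2b-bsdres`, run/shared/lean/b2b/bsd-rank1-residual/, verbatim in every
file): the goal of the cell is to DELETE the COMBINATION-SHAPED residual classes of the
Birch–Swinnerton-Dyer formula for ALL analytic-rank `≤ 1` elliptic curves over `ℚ` — "full BSD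
formula for every rank `≤ 1` curve in class `C`" assembled STRICTLY from published theorems — so
that the rank-`≤ 1` remainder becomes exactly the CONSTRUCTION-SHAPED classes, which are TYPED
(missing-input `Prop`s), NOT attempted. This is not "finishing BSD". Team n1011 (N10/N11: X4 ∧
`p = 3`): research routes on CONSTRUCTION-SHAPED classes; census output = EVIDENCE / conjecture
items, never a Literature fact; RESIDUAL-MAP marks UNCHANGED; nothing is booked by this file.
THEOREMS ONLY: no definition, no named fact, nothing asserted; local arithmetic tools.

## What and why (row T-E3g-DOOR = r2 ROUTE-2 II.18.4 / ST-18.2 STEP 1, the LOCAL half of the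
## "joint door"; a SIZING statement — which local classes can enter the Route-G budget)

For an elliptic curve `E = W` over a number field `K`, a prime `p`, a finite place `v ∤ p`, and ANY
subgroup `H ≤ Γ_{K_v}` containing the inertia group `I_v = absInertia K_v` (e.g.
`H = Gal(K̄_v/K_{∞,η})` for a `ℤ_p`-extension, or `H = Gal(K̄_v/L_w)` for an unramified `L_w/K_v`):

* `exists_fixed_sub_pow_nsmul_mem_primaryComponent`: **every `S ∈ E(K̄_v)^H` is `p^k • R` for some
  `R ∈ E(K̄_v)^H` up to a `p`-power torsion point** — `E(K̄_v)^H / E(K̄_v)^H[p^∞]` is `p`-divisible.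

This is Greenberg's "`E(K_η) ⊗ ℚ_p/ℤ_p = 0` for `η ∤ p`" (LNM 1716, Prop. 2.1, p. 72; Lemma 3.3,
p. 87: "`B_v` … has bounded order") in `E(K̄_v)`-coefficients, and it is EXACTLY the step `hdiv` in
the proof of the tree's `WeierstrassCurve.finite_localTowerKerPrimary_zero_of_not_mem`
(`IwasawaSelmerControlAwayFromPProofs`), which proves it for `H = Gal(K̄_v/K_{∞,η})` as a `have`
and does not export it.  The proof here is that proof, for a general `H ⊇ I_v` and a general
exponent `p^k`: along the `Γ_{K_v}`-equivariant transport `E(K̄_v) ≃ V(K̄_v)` to the minimal model,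
(a) some `m • S`, `m = p^a b ≥ 1`, `p ∤ b`, lies in the kernel of reduction `E₁`
(`exists_nsmul_mem_kernel_of_forall_inertia`: Kodaira–Néron over `K_v^nr`, the reduced group being
torsion), (b) `[p^{a+k}]` is inverted on the inertia-fixed part of `E₁` preserving stabilisers
(`exists_pow_nsmul_eq_of_mem_kernel`: successive approximation in the complete unramified layers,
`E₁` has no `p`-torsion), (c) Bézout `αb + βp^k = 1`.

Consumer: FILE B of this row (`Additive/UnramifiedKummerDoor.lean`): a class of
`H¹(K_v, E[p^k])` dying in `H¹(H, E(K̄_v))` already dies in `H¹(H, E[p^∞])` — the `E(K̄_v)` to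
`E[p^∞]` coefficient change behind the CONVERSE of p10's
`layerToInfty_resH1Hom_torsionToPrimaryH1_mem_localKerOver_of_mem_unramified_sup_kummer`.

References: R. Greenberg, LNM 1716 (1999) §2 Prop. 2.1 (p. 72), §3 Lemma 3.3 (pp. 86–87)
[GreenbergLNM1716]; J. H. Silverman, *AEC* 2nd ed. (2009) Prop. VII.2.1, VII.3.1, Cor. VII.6.2,
IV.2.3 [SilvermanAEC2009].
-/

set_option autoImplicit false

noncomputable section

open scoped Classical NNReal

open NumberField IsDedekindDomain Field IsDedekindDomain.HeightOneSpectrum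
open Literature.NumberTheory.EllipticCurves Literature.NumberTheory.GaloisRepresentations
  Literature.NumberTheory.GaloisRepresentations.IsNonarchimedeanLocalField
  Literature.NumberTheory.EllipticCurves.FormalGroupChart

namespace Summit.BirchSwinnertonDyer.Rank1Residual.Additive

universe u

variable {K : Type u} [Field K] [NumberField K] (W : WeierstrassCurve K) [W.IsElliptic] (p : ℕ)
  [hp : Fact p.Prime] (v : HeightOneSpectrum (𝓞 K))

/-- **`E(K̄_v)^H` is `p`-divisible modulo `p`-power torsion, for every `H ⊇ I_v` at `v ∤ p`.** Let
`E = W` be an elliptic curve over a number field `K`, `p` a prime, `v ∤ p` a finite place, and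
`H ≤ Γ_{K_v}` a subgroup containing the inertia group `absInertia K_v`.  For every point
`S ∈ E(K̄_v)` fixed by `H` and every `k`, there is a point `R ∈ E(K̄_v)` fixed by `H` with
`S − p^k • R ∈ E(K̄_v)[p^∞]`.  (Greenberg: "`E(K_η) ⊗ ℚ_p/ℤ_p = 0`" at `η ∤ p`; proof = the `hdiv`
step of the tree's `finite_localTowerKerPrimary_zero_of_not_mem`: on the minimal model,
`m • S ∈ E₁` with `m = p^a b`, `p ∤ b` (Kodaira–Néron over `K_v^nr` + torsion reduced group),
`m • S = p^{a+k} • u` with `u ∈ E₁` fixed by the stabiliser of `m • S`, and Bézout.)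
[cite: GreenbergLNM1716, §2 Prop. 2.1 (p. 72) and §3 Lemma 3.3 (p. 87)]
[cite: SilvermanAEC2009, Cor. VII.6.2, Prop. VII.2.1, Prop. VII.3.1] -/
theorem exists_fixed_sub_pow_nsmul_mem_primaryComponent (hpv : ((p : ℕ) : 𝓞 K) ∉ v.asIdeal)
    (H : Subgroup (absoluteGaloisGroup (v.adicCompletion K)))
    (hIH : absInertia (v.adicCompletion K) ≤ H) (S : localPoints W (v.adicCompletion K))
    (hS : ∀ h ∈ H, h • S = S) (k : ℕ) :
    ∃ R : localPoints W (v.adicCompletion K), (∀ h ∈ H, h • R = R) ∧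
      S - p ^ k • R ∈ AddCommGroup.primaryComponent (localPoints W (v.adicCompletion K)) p := by
  -- notation
  let G : Type u := absoluteGaloisGroup (v.adicCompletion K)
  let Pt : Type u := localPoints W (v.adicCompletion K)
  -- the spectral valuation, a prime `𝔐` of `𝒪̄_v`, `p ∈ 𝓞_vˣ`, inertia `= absInertia`
  obtain ⟨w, hw⟩ := v.exists_spectralValuation
  obtain ⟨𝔐, h𝔐⟩ := v.localPrimesAbove_nonempty
  have hpu : IsUnit ((p : ℕ) : (v.adicCompletionIntegers K)) := by
    have h := isUnit_algebraMap_adicCompletionIntegers K v hpv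
    rwa [map_natCast] at h
  have hIeq : 𝔐.inertia G = absInertia (v.adicCompletion K) := v.inertia_eq_absInertia hw h𝔐
  have hI : ∀ τ ∈ 𝔐.inertia G, τ ∈ H := fun τ hτ ↦ hIH (hIeq ▸ hτ)
  -- the equivariant transport `E(K̄_v) ≃ V(K̄_v)` to the minimal model
  obtain ⟨C, hC⟩ := W.exists_variableChange_eq_localMinimalIntegralModel v
  haveI := WeierstrassCurve.isIntegral_spectralValuation_baseChange hw (W.localMinimalIntegralModel v)
  have hC' := congrArg (fun X : WeierstrassCurve (v.adicCompletion K) ↦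
    X.baseChange (AlgebraicClosure (v.adicCompletion K))) hC
  let Φ : Pt ≃+ (((W.localMinimalIntegralModel v).map (algebraMap (v.adicCompletionIntegers K)
      (v.adicCompletion K))).baseChange (AlgebraicClosure (v.adicCompletion K))).toAffine.Point :=
    ((WeierstrassCurve.Affine.Point.congrEquiv
        (WeierstrassCurve.baseChange_baseChange_adicCompletion W v).symm).trans
      (WeierstrassCurve.VariableChange.pointEquivBaseChange (W.baseChange (v.adicCompletion K)) C
        (AlgebraicClosure (v.adicCompletion K)))).trans
      (WeierstrassCurve.Affine.Point.congrEquiv hC')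
  have hΦ : ∀ (σ : G) (Q : Pt), Φ (σ • Q) = WeierstrassCurve.Affine.Point.map
      ((absoluteGaloisGroup.toAlgEquiv (v.adicCompletion K) σ :
        AlgebraicClosure (v.adicCompletion K) ≃ₐ[v.adicCompletion K]
          AlgebraicClosure (v.adicCompletion K)) :
        AlgebraicClosure (v.adicCompletion K) →ₐ[v.adicCompletion K]
          AlgebraicClosure (v.adicCompletion K)) (Φ Q) := by
    intro σ Q
    change WeierstrassCurve.Affine.Point.congrEquiv hC'
        (WeierstrassCurve.VariableChange.pointEquivBaseChange (W.baseChange (v.adicCompletion K)) C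
          (AlgebraicClosure (v.adicCompletion K))
        (WeierstrassCurve.Affine.Point.congrEquiv
          (WeierstrassCurve.baseChange_baseChange_adicCompletion W v).symm (σ • Q))) =
      WeierstrassCurve.Affine.Point.map _ (WeierstrassCurve.Affine.Point.congrEquiv hC'
        (WeierstrassCurve.VariableChange.pointEquivBaseChange (W.baseChange (v.adicCompletion K)) C
          (AlgebraicClosure (v.adicCompletion K))
          (WeierstrassCurve.Affine.Point.congrEquiv
            (WeierstrassCurve.baseChange_baseChange_adicCompletion W v).symm Q)))
    rw [WeierstrassCurve.congrEquiv_smul, WeierstrassCurve.VariableChange.pointEquivBaseChange_map_algEquiv]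
    exact WeierstrassCurve.Affine.Point.congrEquiv_baseChange_map hC _ _
  -- `S`, transported, is fixed by the inertia group
  have hSI : ∀ τ ∈ 𝔐.inertia G, WeierstrassCurve.Affine.Point.map
      ((absoluteGaloisGroup.toAlgEquiv (v.adicCompletion K) τ :
        AlgebraicClosure (v.adicCompletion K) ≃ₐ[v.adicCompletion K]
          AlgebraicClosure (v.adicCompletion K)) :
        AlgebraicClosure (v.adicCompletion K) →ₐ[v.adicCompletion K]
          AlgebraicClosure (v.adicCompletion K)) (Φ S) = Φ S := fun τ hτ ↦ by
    rw [← hΦ]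
    exact congrArg Φ (hS τ (hI τ hτ))
  -- (a) `m • Φ S ∈ E₁` for some `m = p^a b ≥ 1`, `p ∤ b`
  obtain ⟨m, hm, hmK⟩ := W.exists_nsmul_mem_kernel_of_forall_inertia hw h𝔐 (P := Φ S) hSI
  obtain ⟨a, b, hb, hmab⟩ := Nat.exists_eq_pow_mul_and_not_dvd hm.ne' p hp.out.ne_one
  have hmI : ∀ τ ∈ 𝔐.inertia G, WeierstrassCurve.Affine.Point.map
      ((absoluteGaloisGroup.toAlgEquiv (v.adicCompletion K) τ :
        AlgebraicClosure (v.adicCompletion K) ≃ₐ[v.adicCompletion K]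
          AlgebraicClosure (v.adicCompletion K)) :
        AlgebraicClosure (v.adicCompletion K) →ₐ[v.adicCompletion K]
          AlgebraicClosure (v.adicCompletion K)) (m • Φ S) = m • Φ S :=
    fun τ hτ ↦ by rw [map_nsmul, hSI τ hτ]
  -- (b) `m • Φ S = p^(a+k) • u` with `u ∈ E₁` fixed by the stabiliser of `m • Φ S`
  obtain ⟨u, -, hufix, hu⟩ := W.exists_pow_nsmul_eq_of_mem_kernel hw h𝔐 hpu (a + k) hmK hmI
  -- `u` comes from an `H`-fixed point `u'`
  have hu'fix : ∀ h ∈ H, h • Φ.symm u = Φ.symm u := fun h hh ↦ by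
    apply Φ.injective
    rw [hΦ, AddEquiv.apply_symm_apply]
    refine hufix h ?_
    rw [map_nsmul, ← hΦ, hS h hh]
  -- (c) `T₀ = b • S - p^k • u'` is `p^a`-torsion
  have hT₀ : b • S - p ^ k • Φ.symm u ∈ AddCommGroup.primaryComponent Pt p := by
    rw [PrimaryCoinvariants.mem_primaryComponent_iff_exists_nsmul]
    refine ⟨a, ?_⟩
    apply Φ.injective
    simp only [smul_sub, map_sub, map_nsmul, map_zero, AddEquiv.apply_symm_apply]
    rw [← mul_smul, ← mul_smul, ← pow_add, hu, ← hmab, sub_self]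
  -- Bézout `α b + β p^k = 1`
  have hcop : IsCoprime (b : ℤ) ((p : ℤ) ^ k) :=
    (Nat.isCoprime_iff_coprime.mpr ((Nat.Prime.coprime_iff_not_dvd hp.out).mpr hb).symm).pow_right
  obtain ⟨α, β, hαβ⟩ := hcop
  refine ⟨α • Φ.symm u + β • S, fun h hh ↦ by rw [smul_add, smul_comm h α, smul_comm h β,
    hu'fix h hh, hS h hh], ?_⟩
  have e : S - p ^ k • (α • Φ.symm u + β • S) = α • (b • S - p ^ k • Φ.symm u) := by
    have h2 : (1 - (α * b + β * (p : ℤ) ^ k)) • S = 0 := by rw [hαβ, sub_self, zero_smul]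
    have h3 : S - p ^ k • (α • Φ.symm u + β • S) - α • (b • S - p ^ k • Φ.symm u) =
        (1 - (α * b + β * (p : ℤ) ^ k)) • S := by
      module
    rw [← sub_eq_zero, h3, h2]
  rw [e]
  exact AddSubgroup.zsmul_mem _ hT₀ α

/-- **Specialisation `H = I_v`**: every point of `E(K_v^nr) = E(K̄_v)^{I_v}` is `p^k • R` for an
inertia-fixed `R` up to `p`-power torsion (`v ∤ p`). [cite: GreenbergLNM1716, §2 Prop. 2.1 (p. 72)] -/
theorem exists_absInertia_fixed_sub_pow_nsmul_mem_primaryComponent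
    (hpv : ((p : ℕ) : 𝓞 K) ∉ v.asIdeal) (S : localPoints W (v.adicCompletion K))
    (hS : ∀ τ ∈ absInertia (v.adicCompletion K), τ • S = S) (k : ℕ) :
    ∃ R : localPoints W (v.adicCompletion K), (∀ τ ∈ absInertia (v.adicCompletion K), τ • R = R) ∧
      S - p ^ k • R ∈ AddCommGroup.primaryComponent (localPoints W (v.adicCompletion K)) p :=
  exists_fixed_sub_pow_nsmul_mem_primaryComponent W p v hpv (absInertia (v.adicCompletion K)) le_rfl
    S hS k

end Summit.BirchSwinnertonDyer.Rank1Residual.Additive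

end
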